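import Mathlib.Analysis.Distribution.SchwartzSpace.Basic
import Mathlib.Analysis.Calculus.UniformLimitsDeriv
import Mathlib.MeasureTheory.Integral.Bochner.ContinuousLinearMap
import Mathlib.Topology.ContinuousMap.Bounded.Normed
import HarnessLib

/-!
# Tempered distributions commute with Schwartz-valued integrals

A tempered distribution `S ∈ 𝒮'(V)` is continuous for finitely many Schwartz seminorms, so it
"commutes with integrals" of families `a ↦ Ψ a ∈ 𝒮(V)`: if `K ∈ 𝒮(V)` satisfies
`K(x) = ∫ w(a) Ψ(a)(x) da` pointwise, for a continuous family `Ψ` of polynomial seminorm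
growth and a rapidly decreasing weight `w`, then `S(K) = ∫ w(a) S(Ψ a) da`
(`SchwartzMap.apply_eq_integral_of_forall_apply_eq_integral`). This is the form in which
"`𝒲(∫ h(a) F_a da) = ∫ h(a) 𝒲(F_a) da`" is used for Wightman distributions
(Streater–Wightman (1964), §3-4, proof of Thm. 3-7, spectral condition).

Proof (no nuclear/kernel theorem, no vector-valued Riemann sums): embed `𝒮(V)` by finitely
many weighted derivatives `F ↦ ((1 + ‖x‖)^{k₀} Dⁱ F(x))_{i ≤ n₀}` into the Banach space
`B = Π_{i ≤ n₀} C_b(V, V^{⊗ i} → ℂ)` (`derivEmbedding`), so that `|S F| ≤ C ‖J F‖`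
(`exists_bound_derivEmbedding`); the Bochner integral `∫ w(a) (J (Ψ a), S (Ψ a)) da` lies in
the closure `Γ` of the graph `{(J F, S F)}`; elements of the closure of `range J` are
determined by their order-`0` component, because uniform limits of derivatives are derivatives
of the limit (`hasFDerivAt_of_tendstoUniformly`; `eq_zero_of_mem_closure_range`); and `Γ`
contains no `(0, c)` with `c ≠ 0`. Comparing with `(J K, S K) ∈ Γ` gives the claim.

## References
* R. F. Streater, A. S. Wightman, PCT, Spin and Statistics, and All That (1964), §2-1
  (tempered distributions are continuous in finitely many seminorms), §3-4.
* L. Schwartz, Théorie des distributions (1966), Ch. VII (tempered distributions).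
-/

noncomputable section

open Filter Topology MeasureTheory
open scoped SchwartzMap BoundedContinuousFunction ContDiff

namespace SchwartzMap

variable {V : Type*} [NormedAddCommGroup V] [NormedSpace ℝ V]

/-! ## The Banach space of finitely many weighted derivatives -/

variable (V) in
/-- The Banach space receiving the weighted derivatives of orders `≤ n₀`:
`Π_{i ≤ n₀} C_b(V, V^{[×i]} →L ℂ)` (a `def`, so that only the normed-space instances below
are visible). [folklore] -/
def DerivTarget (n₀ : ℕ) : Type _ :=
  (i : Fin (n₀ + 1)) → (V →ᵇ (V [×(i : ℕ)]→L[ℝ] ℂ))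

/-- The sup-norm Banach space structure on `DerivTarget`. [folklore] -/
instance DerivTarget.instNormedAddCommGroup (n₀ : ℕ) : NormedAddCommGroup (DerivTarget V n₀) :=
  Pi.normedAddCommGroup

/-- The `ℂ`-normed space structure on `DerivTarget`. [folklore] -/
instance DerivTarget.instNormedSpace (n₀ : ℕ) : NormedSpace ℂ (DerivTarget V n₀) :=
  Pi.normedSpace

/-- `DerivTarget` is complete. [folklore] -/
instance DerivTarget.instCompleteSpace (n₀ : ℕ) : CompleteSpace (DerivTarget V n₀) :=
  Pi.complete _

/-- The weighted `i`-th derivative `x ↦ (1 + ‖x‖)^{k₀} Dⁱ F(x)` of a Schwartz function as a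
bounded continuous function. [folklore] -/
def weightedDeriv (k₀ n₀ : ℕ) (F : 𝓢(V, ℂ)) (i : Fin (n₀ + 1)) : V →ᵇ (V [×(i : ℕ)]→L[ℝ] ℂ) :=
  BoundedContinuousFunction.ofNormedAddCommGroup
    (fun x => ((1 + ‖x‖) ^ k₀ : ℝ) • iteratedFDeriv ℝ i F x)
    (((continuous_const.add continuous_norm).pow k₀).smul
      ((F.smooth ⊤).continuous_iteratedFDeriv (mod_cast le_top)))
    (2 ^ k₀ * ((Finset.Iic (k₀, n₀)).sup fun m => SchwartzMap.seminorm ℂ m.1 m.2) F)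
    (fun x => by
      rw [norm_smul, Real.norm_of_nonneg (by positivity)]
      exact one_add_le_sup_seminorm_apply (𝕜 := ℂ) (m := (k₀, n₀)) le_rfl
        (Nat.lt_succ_iff.1 i.2) F x)

/-- Pointwise formula for `weightedDeriv`. [folklore] -/
@[simp] theorem weightedDeriv_apply (k₀ n₀ : ℕ) (F : 𝓢(V, ℂ)) (i : Fin (n₀ + 1)) (x : V) :
    weightedDeriv k₀ n₀ F i x = ((1 + ‖x‖) ^ k₀ : ℝ) • iteratedFDeriv ℝ i F x := rfl

/-- `weightedDeriv` is additive in the Schwartz function. [folklore] -/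
theorem weightedDeriv_add (k₀ n₀ : ℕ) (F G : 𝓢(V, ℂ)) (i : Fin (n₀ + 1)) :
    weightedDeriv k₀ n₀ (F + G) i = weightedDeriv k₀ n₀ F i + weightedDeriv k₀ n₀ G i := by
  ext x v
  simp only [weightedDeriv_apply, BoundedContinuousFunction.coe_add, Pi.add_apply,
    smul_apply, add_apply]
  rw [show ⇑(F + G) = ⇑F + ⇑G from rfl, iteratedFDeriv_add_apply
    ((F.smooth ⊤).contDiffAt.of_le (mod_cast le_top))
    ((G.smooth ⊤).contDiffAt.of_le (mod_cast le_top))]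
  simp [smul_add]

/-- `weightedDeriv` is homogeneous in the Schwartz function. [folklore] -/
theorem weightedDeriv_smul (k₀ n₀ : ℕ) (c : ℂ) (F : 𝓢(V, ℂ)) (i : Fin (n₀ + 1)) :
    weightedDeriv k₀ n₀ (c • F) i = c • weightedDeriv k₀ n₀ F i := by
  ext x v
  simp only [weightedDeriv_apply, BoundedContinuousFunction.coe_smul, smul_apply]
  rw [show ⇑(c • F) = c • ⇑F from rfl, iteratedFDeriv_const_smul_apply
    ((F.smooth ⊤).contDiffAt.of_le (mod_cast le_top))]
  simp only [smul_apply, smul_eq_mul, Complex.real_smul]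
  ring

/-- The norm of `weightedDeriv` is controlled by the Schwartz seminorms up to `(k₀, n₀)`. [folklore] -/
theorem norm_weightedDeriv_le (k₀ n₀ : ℕ) (F : 𝓢(V, ℂ)) (i : Fin (n₀ + 1)) :
    ‖weightedDeriv k₀ n₀ F i‖ ≤
      2 ^ k₀ * ((Finset.Iic (k₀, n₀)).sup fun m => SchwartzMap.seminorm ℂ m.1 m.2) F :=
  BoundedContinuousFunction.norm_ofNormedAddCommGroup_le _ (by positivity) _

/-- **The derivative embedding** `J F = ((1 + ‖x‖)^{k₀} Dⁱ F(x))_{i ≤ n₀}` of the Schwartz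
space into the Banach space `DerivTarget V n₀`, a continuous linear map
(`SchwartzMap.mkCLMtoNormedSpace`). [folklore] -/
def derivEmbedding (k₀ n₀ : ℕ) : 𝓢(V, ℂ) →L[ℂ] DerivTarget V n₀ :=
  SchwartzMap.mkCLMtoNormedSpace (𝕜 := ℂ) (𝕜' := ℂ) (σ := RingHom.id ℂ) (D := V) (E := ℂ)
    (G := DerivTarget V n₀)
    (fun F => (fun i => weightedDeriv k₀ n₀ F i : DerivTarget V n₀))
    (fun F G => funext fun i => weightedDeriv_add k₀ n₀ F G i)
    (fun c F => funext fun i => weightedDeriv_smul k₀ n₀ c F i)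
    ⟨Finset.Iic (k₀, n₀), 2 ^ k₀, by positivity, fun F =>
      (pi_norm_le_iff_of_nonneg (by positivity)).2 fun i => norm_weightedDeriv_le k₀ n₀ F i⟩

/-- Components of the derivative embedding. [folklore] -/
@[simp] theorem derivEmbedding_apply_apply (k₀ n₀ : ℕ) (F : 𝓢(V, ℂ)) (i : Fin (n₀ + 1)) :
    derivEmbedding k₀ n₀ F i = weightedDeriv k₀ n₀ F i := rfl

/-- Pointwise formula for the derivative embedding. [folklore] -/
theorem derivEmbedding_apply (k₀ n₀ : ℕ) (F : 𝓢(V, ℂ)) (i : Fin (n₀ + 1)) (x : V) :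
    derivEmbedding k₀ n₀ F i x = ((1 + ‖x‖) ^ k₀ : ℝ) • iteratedFDeriv ℝ i F x := rfl

/-- The norm of the embedding is controlled by the Schwartz seminorms up to `(k₀, n₀)`. [folklore] -/
theorem norm_derivEmbedding_le (k₀ n₀ : ℕ) (F : 𝓢(V, ℂ)) :
    ‖derivEmbedding k₀ n₀ F‖ ≤
      2 ^ k₀ * ((Finset.Iic (k₀, n₀)).sup fun m => SchwartzMap.seminorm ℂ m.1 m.2) F :=
  (pi_norm_le_iff_of_nonneg (by positivity)).2 fun i => norm_weightedDeriv_le k₀ n₀ F i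

/-- The Schwartz seminorms of orders `≤ (k₀, n₀)` are bounded by the norm of the embedding. [folklore] -/
theorem seminorm_le_norm_derivEmbedding {k₀ n₀ k i : ℕ} (hk : k ≤ k₀) (hi : i ≤ n₀)
    (F : 𝓢(V, ℂ)) : SchwartzMap.seminorm ℂ k i F ≤ ‖derivEmbedding k₀ n₀ F‖ := by
  refine SchwartzMap.seminorm_le_bound ℂ k i F (norm_nonneg _) fun x => ?_
  have h1 : ‖x‖ ^ k ≤ (1 + ‖x‖) ^ k₀ :=
    (pow_le_pow_left₀ (norm_nonneg _) (by linarith [norm_nonneg x]) k).trans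
      (pow_le_pow_right₀ (by linarith [norm_nonneg x]) hk)
  set i' : Fin (n₀ + 1) := ⟨i, Nat.lt_succ_iff.2 hi⟩
  calc ‖x‖ ^ k * ‖iteratedFDeriv ℝ i F x‖ ≤ (1 + ‖x‖) ^ k₀ * ‖iteratedFDeriv ℝ i F x‖ := by
        gcongr
    _ = ‖weightedDeriv k₀ n₀ F i' x‖ := by
        rw [weightedDeriv_apply, norm_smul, Real.norm_of_nonneg (by positivity)]
    _ ≤ ‖weightedDeriv k₀ n₀ F i'‖ := (weightedDeriv k₀ n₀ F i').norm_coe_le_norm x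
    _ ≤ ‖derivEmbedding k₀ n₀ F‖ := norm_le_pi_norm (f := derivEmbedding k₀ n₀ F) i'

/-- **A tempered distribution is bounded by finitely many seminorms**, hence by the norm of a
derivative embedding: `|S F| ≤ C ‖J_{k₀,n₀} F‖` (Streater–Wightman (1964), §2-1). [cite: StreaterWightman1964, §2-1] -/
theorem exists_bound_derivEmbedding (S : 𝓢(V, ℂ) →L[ℂ] ℂ) :
    ∃ (k₀ n₀ : ℕ) (C : ℝ), 0 ≤ C ∧ ∀ F, ‖S F‖ ≤ C * ‖derivEmbedding k₀ n₀ F‖ := by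
  set q : Seminorm ℂ 𝓢(V, ℂ) := (normSeminorm ℂ ℂ).comp S.toLinearMap
  have hq : Continuous q := continuous_norm.comp S.continuous
  obtain ⟨s, C, _, hle⟩ := Seminorm.bound_of_continuous (schwartz_withSeminorms ℂ V ℂ) q hq
  refine ⟨s.sup Prod.fst, s.sup Prod.snd, C, NNReal.coe_nonneg C, fun F => ?_⟩
  have h1 : ‖S F‖ = q F := rfl
  rw [h1]
  refine (hle F).trans ?_
  change C • (s.sup (schwartzSeminormFamily ℂ V ℂ)) F ≤ _
  rw [NNReal.smul_def, smul_eq_mul]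
  gcongr
  refine Seminorm.finset_sup_apply_le (norm_nonneg _) fun m hm => ?_
  rw [schwartzSeminormFamily_apply]
  exact seminorm_le_norm_derivEmbedding (Finset.le_sup (f := Prod.fst) hm)
    (Finset.le_sup (f := Prod.snd) hm) F

/-! ## Elements of the closure of the range are determined by their values -/

/-- **Closure trick**: an element of the closure of the range of the derivative embedding whose
order-`0` component vanishes is `0` — its higher components are uniform limits of derivatives
of functions converging uniformly to `0`, hence `0` (`hasFDerivAt_of_tendstoUniformly`). [folklore] -/
theorem eq_zero_of_mem_closure_range {k₀ n₀ : ℕ} {z : DerivTarget V n₀}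
    (hz : z ∈ closure (Set.range (derivEmbedding (V := V) k₀ n₀)))
    (h0 : ∀ x v, z ⟨0, Nat.succ_pos n₀⟩ x v = 0) : z = 0 := by
  obtain ⟨u, hu, hlim⟩ := mem_closure_iff_seq_limit.1 hz
  choose F hF using hu
  -- the renormalised components of `z`
  set g : (i : Fin (n₀ + 1)) → V → (V [×(i : ℕ)]→L[ℝ] ℂ) := fun i x => ((1 + ‖x‖) ^ k₀ : ℝ)⁻¹ • z i x
  have hnorm : Tendsto (fun j => ‖derivEmbedding k₀ n₀ (F j) - z‖) atTop (𝓝 0) := by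
    have h := (tendsto_iff_norm_sub_tendsto_zero (E := DerivTarget V n₀)).1 hlim
    refine h.congr fun j => ?_
    rw [hF j]
  -- uniform closeness of the derivatives of `F j` to `g i`
  have hclose : ∀ (i : Fin (n₀ + 1)) (j : ℕ) (x : V),
      ‖g i x - iteratedFDeriv ℝ i (F j) x‖ ≤ ‖derivEmbedding k₀ n₀ (F j) - z‖ := by
    intro i j x
    have hw : 0 < (1 + ‖x‖) ^ k₀ := by positivity
    have h1 : g i x - iteratedFDeriv ℝ i (F j) x =
        ((1 + ‖x‖) ^ k₀ : ℝ)⁻¹ • (z i x - derivEmbedding k₀ n₀ (F j) i x) := by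
      simp only [g, derivEmbedding_apply, smul_sub, inv_smul_smul₀ hw.ne']
    rw [h1, norm_smul, norm_inv, Real.norm_of_nonneg hw.le]
    calc ((1 + ‖x‖) ^ k₀)⁻¹ * ‖z i x - derivEmbedding k₀ n₀ (F j) i x‖
        ≤ 1 * ‖z i x - derivEmbedding k₀ n₀ (F j) i x‖ := by
          gcongr
          exact inv_le_one_of_one_le₀ (one_le_pow₀ (by linarith [norm_nonneg x]))
      _ = ‖(z - derivEmbedding k₀ n₀ (F j)) i x‖ := by rw [one_mul]; rfl
      _ ≤ ‖(z - derivEmbedding k₀ n₀ (F j)) i‖ := ((z - derivEmbedding k₀ n₀ (F j)) i).norm_coe_le_norm x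
      _ ≤ ‖z - derivEmbedding k₀ n₀ (F j)‖ := norm_le_pi_norm (f := z - derivEmbedding k₀ n₀ (F j)) i
      _ = ‖derivEmbedding k₀ n₀ (F j) - z‖ := norm_sub_rev _ _
  have hunif : ∀ i : Fin (n₀ + 1),
      TendstoUniformly (fun j x => iteratedFDeriv ℝ i (F j) x) (g i) atTop := by
    intro i
    refine Metric.tendstoUniformly_iff.2 fun ε hε => ?_
    filter_upwards [(tendsto_order.1 hnorm).2 ε hε] with j hj x
    rw [dist_eq_norm]
    exact (hclose i j x).trans_lt hj
  -- induction on the order: all `g i` vanish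
  have hmain : ∀ (i : ℕ) (hi : i < n₀ + 1), ∀ x, g ⟨i, hi⟩ x = 0 := by
    intro i
    induction i with
    | zero =>
      intro hi x
      have h0' : z ⟨0, hi⟩ x = 0 := ContinuousMultilinearMap.ext fun v => h0 x v
      simp only [g]
      rw [h0']
      exact smul_zero (M := ℝ) (A := V [×0]→L[ℝ] ℂ) _
    | succ i ih =>
      intro hi x
      have hi' : i < n₀ + 1 := Nat.lt_of_succ_lt hi
      have ih' : ∀ x, g ⟨i, hi'⟩ x = 0 := ih hi'
      set e := continuousMultilinearCurryLeftEquiv ℝ (fun _ : Fin (i + 1) => V) ℂ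
      have hderiv : ∀ (j : ℕ) (y : V), HasFDerivAt (fun y => iteratedFDeriv ℝ i (F j) y)
          (e (iteratedFDeriv ℝ (i + 1) (F j) y)) y := by
        intro j y
        have hd : DifferentiableAt ℝ (iteratedFDeriv ℝ i (F j)) y :=
          ((F j).smooth ⊤).differentiable_iteratedFDeriv (mod_cast ENat.coe_lt_top i) y
        have := hd.hasFDerivAt
        rwa [fderiv_iteratedFDeriv] at this
      have hunif' : TendstoUniformly (fun j y => e (iteratedFDeriv ℝ (i + 1) (F j) y))
          (fun y => e (g ⟨i + 1, hi⟩ y)) atTop := by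
        have hu := hunif ⟨i + 1, hi⟩
        have he : UniformContinuous e := e.isometry.uniformContinuous
        exact he.comp_tendstoUniformly hu
      have hpt : ∀ y, Tendsto (fun j => iteratedFDeriv ℝ i (F j) y) atTop
          (𝓝 ((0 : V → (V [×i]→L[ℝ] ℂ)) y)) := by
        intro y
        have := (hunif ⟨i, hi'⟩).tendsto_at y
        rwa [ih' y] at this
      have hlim0 := hasFDerivAt_of_tendstoUniformly hunif' hderiv hpt x
      have hzero : HasFDerivAt (0 : V → (V [×i]→L[ℝ] ℂ)) (0 : V →L[ℝ] (V [×i]→L[ℝ] ℂ)) x :=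
        hasFDerivAt_const _ _
      have heq : e (g ⟨i + 1, hi⟩ x) = 0 := hlim0.unique hzero
      exact e.injective (by rw [heq, e.map_zero])
  funext i
  obtain ⟨i, hi⟩ := i
  ext x v
  have hw : ((1 + ‖x‖) ^ k₀ : ℝ) ≠ 0 := by positivity
  have h := hmain i hi x
  simp only [g] at h
  have hz : z ⟨i, hi⟩ x = 0 := by
    have h2 := congrArg (fun u => ((1 + ‖x‖) ^ k₀ : ℝ) • u) h
    simp only [smul_inv_smul₀ hw] at h2
    exact h2.trans (smul_zero (M := ℝ) (A := V [×i]→L[ℝ] ℂ) _)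
  rw [hz]
  rfl

/-! ## The exchange theorem -/

/-- **The graph closure is a graph over the closure of the range**: if `|S F| ≤ C ‖J F‖` then an
element of the closure of `{(J F, S F)}` whose first component has vanishing order-`0` part is
`0` (first by `eq_zero_of_mem_closure_range`, then `S Fⱼ → 0` along `J Fⱼ → 0`). [folklore] -/
theorem graph_closure_eq_zero {k₀ n₀ : ℕ} (S : 𝓢(V, ℂ) →L[ℂ] ℂ) {C : ℝ}
    (hS : ∀ F, ‖S F‖ ≤ C * ‖derivEmbedding k₀ n₀ F‖) {p : DerivTarget V n₀ × ℂ}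
    (hp : p ∈ closure (Set.range fun F => (derivEmbedding k₀ n₀ F, S F)))
    (hp0 : ∀ x v, p.1 ⟨0, Nat.succ_pos n₀⟩ x v = 0) : p = 0 := by
  have h1 : p.1 ∈ closure (Set.range (derivEmbedding (V := V) k₀ n₀)) := by
    have : p.1 ∈ Prod.fst '' closure (Set.range fun F => (derivEmbedding k₀ n₀ F, S F)) :=
      ⟨p, hp, rfl⟩
    refine closure_mono ?_ (image_closure_subset_closure_image continuous_fst this)
    rintro _ ⟨_, ⟨F, rfl⟩, rfl⟩
    exact ⟨F, rfl⟩
  have hp1 : p.1 = 0 := eq_zero_of_mem_closure_range h1 hp0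
  obtain ⟨u, hu, hlim⟩ := mem_closure_iff_seq_limit.1 hp
  choose F hF using hu
  have hJ : Tendsto (fun j => derivEmbedding k₀ n₀ (F j)) atTop (𝓝 0) := by
    have h := (continuous_fst.tendsto p).comp hlim
    rw [hp1] at h
    refine h.congr fun j => ?_
    simp only [Function.comp_apply, ← hF j]
  have hSF : Tendsto (fun j => S (F j)) atTop (𝓝 p.2) := by
    have h := (continuous_snd.tendsto p).comp hlim
    refine h.congr fun j => ?_
    simp only [Function.comp_apply, ← hF j]
  have hS0 : Tendsto (fun j => S (F j)) atTop (𝓝 0) := by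
    rw [tendsto_zero_iff_norm_tendsto_zero]
    have hb : Tendsto (fun j => C * ‖derivEmbedding k₀ n₀ (F j)‖) atTop (𝓝 0) := by
      simpa using (tendsto_zero_iff_norm_tendsto_zero.1 hJ).const_mul C
    exact squeeze_zero (fun _ => norm_nonneg _) (fun j => hS (F j)) hb
  exact Prod.ext hp1 (tendsto_nhds_unique hSF hS0)

section Exchange

variable {E : Type*} [NormedAddCommGroup E] [MeasurableSpace E] [OpensMeasurableSpace E]
  [SecondCountableTopology E] {μ : Measure E}

set_option synthInstance.maxHeartbeats 80000 in
set_option maxHeartbeats 800000 in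
/-- **Tempered distributions commute with Schwartz-valued integrals.** Let `S ∈ 𝒮'(V)`, let
`Ψ : E → 𝒮(V)` be continuous with seminorms of polynomial growth, `w : E → ℂ` continuous with
`(1 + ‖a‖)^N w(a)` integrable for all `N`, and let `K ∈ 𝒮(V)` satisfy
`K(x) = ∫ w(a) Ψ(a)(x) da` for all `x`. Then `S(K) = ∫ w(a) S(Ψ a) da`
(Streater–Wightman (1964), §3-4, the step "`∫ e^{-ipa} d⟪Φ, E(p) Ψ⟫`" in the proof of
Thm. 3-7; Schwartz (1966), Ch. VII). [cite: StreaterWightman1964, §3-4] -/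
theorem apply_eq_integral_of_forall_apply_eq_integral
    (S : 𝓢(V, ℂ) →L[ℂ] ℂ) (Ψ : E → 𝓢(V, ℂ)) (hΨ : Continuous Ψ)
    (hgrowth : ∀ k n : ℕ, ∃ (C : ℝ) (N : ℕ), ∀ a, SchwartzMap.seminorm ℂ k n (Ψ a) ≤ C * (1 + ‖a‖) ^ N)
    (w : E → ℂ) (hw : Continuous w) (hwi : ∀ N : ℕ, Integrable (fun a => (1 + ‖a‖) ^ N * ‖w a‖) μ)
    (K : 𝓢(V, ℂ)) (hK : ∀ x, K x = ∫ a, w a * Ψ a x ∂μ) :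
    S K = ∫ a, w a * S (Ψ a) ∂μ := by
  obtain ⟨k₀, n₀, C, hC, hS⟩ := exists_bound_derivEmbedding S
  set J := derivEmbedding (V := V) k₀ n₀ with hJdef
  -- the closed subspace `Γ = closure {(J F, S F)}`
  obtain ⟨Γ, hΓ⟩ : ∃ Γ : Submodule ℂ (DerivTarget V n₀ × ℂ),
      (Γ : Set (DerivTarget V n₀ × ℂ)) = closure (Set.range fun F => (J F, S F)) :=
    ⟨(LinearMap.range (J.prod S).toLinearMap).topologicalClosure, by
      rw [Submodule.topologicalClosure_coe, LinearMap.coe_range]; rfl⟩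
  have hΓclosed : IsClosed (Γ : Set (DerivTarget V n₀ × ℂ)) := by rw [hΓ]; exact isClosed_closure
  haveI : CompleteSpace Γ := hΓclosed.completeSpace_coe
  haveI : SecondCountableTopologyEither E Γ := secondCountableTopologyEither_of_left E Γ
  have hΓmem : ∀ F, (J F, S F) ∈ Γ := fun F => by
    rw [← SetLike.mem_coe, hΓ]; exact subset_closure ⟨F, rfl⟩
  -- the `Γ`-valued integrand
  set ΦΓ : E → Γ := fun a => ⟨(J (Ψ a), S (Ψ a)), hΓmem (Ψ a)⟩
  have hΦΓc : Continuous ΦΓ :=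
    ((J.continuous.comp hΨ).prodMk (S.continuous.comp hΨ)).subtype_mk _
  -- polynomial bound on the integrand
  have hbound : ∃ (C' : ℝ) (N : ℕ), ∀ a, ‖(ΦΓ a : DerivTarget V n₀ × ℂ)‖ ≤ C' * (1 + ‖a‖) ^ N := by
    choose Cg Ng hg using hgrowth
    set N : ℕ := (Finset.Iic (k₀, n₀)).sup fun m => Ng m.1 m.2
    set Cs : ℝ := ∑ m ∈ Finset.Iic (k₀, n₀), |Cg m.1 m.2|
    have hsem : ∀ a, ((Finset.Iic (k₀, n₀)).sup fun m => SchwartzMap.seminorm ℂ m.1 m.2) (Ψ a) ≤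
        Cs * (1 + ‖a‖) ^ N := by
      intro a
      refine Seminorm.finset_sup_apply_le (by positivity) fun m hm => ?_
      have h1a : (1 : ℝ) ≤ 1 + ‖a‖ := by linarith [norm_nonneg a]
      calc SchwartzMap.seminorm ℂ m.1 m.2 (Ψ a) ≤ Cg m.1 m.2 * (1 + ‖a‖) ^ Ng m.1 m.2 := hg _ _ a
        _ ≤ |Cg m.1 m.2| * (1 + ‖a‖) ^ N :=
            mul_le_mul (le_abs_self _)
              (pow_le_pow_right₀ h1a (Finset.le_sup (f := fun m : ℕ × ℕ => Ng m.1 m.2) hm))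
              (by positivity) (abs_nonneg _)
        _ ≤ Cs * (1 + ‖a‖) ^ N := by
            gcongr
            exact Finset.single_le_sum (f := fun m : ℕ × ℕ => |Cg m.1 m.2|)
              (fun _ _ => abs_nonneg _) hm
    have hJa : ∀ a, ‖J (Ψ a)‖ ≤ 2 ^ k₀ * (Cs * (1 + ‖a‖) ^ N) := fun a =>
      (norm_derivEmbedding_le k₀ n₀ (Ψ a)).trans (by gcongr; exact hsem a)
    refine ⟨2 ^ k₀ * Cs + C * (2 ^ k₀ * Cs), N, fun a => ?_⟩
    calc ‖(ΦΓ a : DerivTarget V n₀ × ℂ)‖ = max ‖J (Ψ a)‖ ‖S (Ψ a)‖ := rfl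
      _ ≤ ‖J (Ψ a)‖ + ‖S (Ψ a)‖ :=
          max_le (le_add_of_nonneg_right (norm_nonneg _)) (le_add_of_nonneg_left (norm_nonneg _))
      _ ≤ 2 ^ k₀ * (Cs * (1 + ‖a‖) ^ N) + C * (2 ^ k₀ * (Cs * (1 + ‖a‖) ^ N)) := by
          gcongr
          · exact hJa a
          · exact (hS _).trans (by gcongr; exact hJa a)
      _ = (2 ^ k₀ * Cs + C * (2 ^ k₀ * Cs)) * (1 + ‖a‖) ^ N := by ring
  obtain ⟨C', N, hC'⟩ := hbound
  have hint : Integrable (fun a => w a • ΦΓ a) μ := by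
    refine Integrable.mono' ((hwi N).const_mul |C'|) (hw.aestronglyMeasurable.smul
      hΦΓc.aestronglyMeasurable) (Eventually.of_forall fun a => ?_)
    rw [norm_smul, show ‖ΦΓ a‖ = ‖(ΦΓ a : DerivTarget V n₀ × ℂ)‖ from rfl]
    calc ‖w a‖ * ‖(ΦΓ a : DerivTarget V n₀ × ℂ)‖ ≤ ‖w a‖ * (|C'| * (1 + ‖a‖) ^ N) := by
          gcongr
          exact (hC' a).trans (mul_le_mul_of_nonneg_right (le_abs_self _) (by positivity))
      _ = |C'| * ((1 + ‖a‖) ^ N * ‖w a‖) := by ring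
  -- the integral in `Γ` and its two projections
  set y : Γ := ∫ a, w a • ΦΓ a ∂μ
  have hy2 : ((y : DerivTarget V n₀ × ℂ)).2 = ∫ a, w a * S (Ψ a) ∂μ := by
    set L : Γ →L[ℂ] ℂ := (ContinuousLinearMap.snd ℂ (DerivTarget V n₀) ℂ).comp Γ.subtypeL
    have h := ContinuousLinearMap.integral_comp_comm (𝕜 := ℂ) L hint
    have h' : ∀ a, L (w a • ΦΓ a) = w a * S (Ψ a) := fun a => by
      rw [map_smul, smul_eq_mul]
      rfl
    simp only [h'] at h
    rw [h]
    rfl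
  have hy0 : ∀ (x : V) (v : Fin 0 → V),
      ((y : DerivTarget V n₀ × ℂ)).1 ⟨0, Nat.succ_pos n₀⟩ x v = J K ⟨0, Nat.succ_pos n₀⟩ x v := by
    intro x v
    -- the real-linear functional "order-`0` component, evaluated at `x` and at `v`"
    set i₀ : Fin (n₀ + 1) := ⟨0, Nat.succ_pos n₀⟩
    set ev₀ : (V [×0]→L[ℝ] ℂ) →L[ℝ] ℂ := ContinuousMultilinearMap.apply ℝ (fun _ : Fin 0 => V) ℂ v
    set π₀ : DerivTarget V n₀ →L[ℝ] (V →ᵇ (V [×0]→L[ℝ] ℂ)) :=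
      (ContinuousLinearMap.proj (R := ℂ) (φ := fun i : Fin (n₀ + 1) => V →ᵇ (V [×(i : ℕ)]→L[ℝ] ℂ))
        i₀).restrictScalars ℝ
    set ev : (DerivTarget V n₀ × ℂ) →L[ℝ] ℂ :=
      ev₀.comp (((BoundedContinuousFunction.evalCLM ℝ x).comp π₀).comp
        (ContinuousLinearMap.fst ℝ (DerivTarget V n₀) ℂ))
    have hev : ∀ q : DerivTarget V n₀ × ℂ, ev q = q.1 i₀ x v := fun q => rfl
    set L : Γ →L[ℝ] ℂ := ev.comp (Γ.subtypeL.restrictScalars ℝ)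
    have h1 := ContinuousLinearMap.integral_comp_comm (𝕜 := ℝ) L hint
    have h2 : ∀ a, L (w a • ΦΓ a) = w a * (((1 + ‖x‖) ^ k₀ : ℝ) * Ψ a x) := by
      intro a
      change ev ((w a • ΦΓ a : Γ) : DerivTarget V n₀ × ℂ) = _
      rw [Submodule.coe_smul, hev]
      change (w a • J (Ψ a)) i₀ x v = _
      rw [show (w a • J (Ψ a)) i₀ x v = w a * J (Ψ a) i₀ x v from rfl, derivEmbedding_apply]
      simp [i₀, iteratedFDeriv_zero_apply, Complex.real_smul]
    simp only [h2] at h1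
    have hL : L y = ((y : DerivTarget V n₀ × ℂ)).1 i₀ x v := rfl
    rw [← hL, ← h1, derivEmbedding_apply]
    simp only [smul_apply, iteratedFDeriv_zero_apply, Complex.real_smul]
    rw [hK x, ← integral_const_mul]
    refine integral_congr_ae (Eventually.of_forall fun a => ?_)
    simp only
    ring
  -- the difference lies in `Γ` and has vanishing order-`0` component
  have hmem : (y : DerivTarget V n₀ × ℂ) - (J K, S K) ∈ closure (Set.range fun F => (J F, S F)) := by
    rw [← hΓ]
    exact Γ.sub_mem y.2 (hΓmem K)
  have hdiff := graph_closure_eq_zero S hS hmem fun x v => by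
    change ((y : DerivTarget V n₀ × ℂ)).1 ⟨0, Nat.succ_pos n₀⟩ x v - J K ⟨0, Nat.succ_pos n₀⟩ x v = 0
    rw [hy0 x v, sub_self]
  have h2 := congrArg Prod.snd hdiff
  rw [Prod.snd_sub, hy2, Prod.snd_zero, sub_eq_zero] at h2
  exact h2.symm

end Exchange

end SchwartzMap
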